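import Summits.NavierStokesRegularity.FluidComputer.TypeIGradientFace
import Summits.NavierStokesRegularity.FluidComputer.SummedOccupationBridge
import HarnessLib

/-!
# Fluid computer — L63′: the Type-I gradient threshold IN LEVEL CURRENCY — the Lipschitz row
# `R(t) = ∑_l 2^l ‖Δ̇_l u(t)‖_∞` must reach `1/(C_L (T − t))` again and again

HONEST FRAMING (cell `pub-fluidc`, verbatim): *low prior, high value-of-information experiment on Tao's
machine paradigm; NOT a claim that NS blows up.* Theorem side of the cell (the level dictionary); nothing here is
evidence of blow-up — necessities for EVERY maximal smooth finite-energy solution on `ℝ³`.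

L63 (`TypeIGradientFace.ns_typeI_gradient_threshold`) is stated with `sup_x ‖∇u(t, x)‖`; the machine paradigm reads
LEVELS — the block sups `s_l(t) = ‖Δ̇_l u(t)‖_∞` (the saturation observables of the dictionary, L1–L11, L22). The
Littlewood–Paley reconstruction of one derivative in `L^∞` (`SummedOccupationBridge.exists_eLpNorm_fderiv_apply_le_tsum`:
`‖∂_m v‖_∞ ≤ C‖m‖ ∑_l 2^l s_l`, Bernstein block by block) bounds the full gradient: `sup_x ‖∇v(x)‖ ≤ C_L ∑_l 2^l s_l(v)`
with an absolute `C_L`. Hence, along every maximal smooth solution `(u, p)` of the unforced Navier–Stokes system on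
`ℝ³ × [0, T)` (`ν > 0`) which is Leray–Hopf from `u 0`:

* `exists_iSup_fderiv_le_lipschitzRow` — the slice inequality `sup_x ‖∇v(x)‖ ≤ C_L ∑_l 2^l ‖Δ̇_l v‖_∞` for smooth `L²`
  fields (an absolute `C_L`);
* `lipschitzRow_weak_clock` (**L63′ — THE LIPSCHITZ ROW AT THE SELF-SIMILAR RATE, WEAK FORM**): with that `C_L`, for
  every `M₀ < 1` and every `t₀ ∈ [0, T)` some `t ∈ [t₀, T) ∩ (0, T)` has `M₀/(T − t) < C_L · ∑_l 2^l s_l(t)` — i.e.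
  `limsup_{t↑T} (T − t)·∑_l 2^l ‖Δ̇_l u(t)‖_∞ ≥ 1/C_L`: the `2^l`-weighted row of block sups (`≃ ‖u(t)‖_{Ḃ¹_{∞,1}}`) must
  reach the self-similar level `≈ 1/(T − t)` at times arbitrarily close to `T`;
* `lipschitzRow_weak_clock_frequently` — filter form.

Placement: L22 (`LeraySupClock.blockSup_sum_clock`) bounds the UNWEIGHTED sum `∑_l s_l ≥ c√(ν/(T − t))` at EVERY `t`
(Leray's `L^∞` rate, with `ν`); L63′ bounds the `2^l`-WEIGHTED sum at the rate `1/(T − t)` with NO `ν`, along a sequence.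
L61 bounds the larger `ℓ¹` row `∑_l 2^{5l/2} a_l ≥ C_B^{-1} ∑_l 2^l s_l` strongly (every `t`); L63′ is not implied by it.
HONEST: `C_L` is an inexplicit Littlewood–Paley constant (the `1` of L63 divided by the reconstruction constant); weak
form only. Necessity only. 0 sorry; no definitions; no named facts.

## References

* D. Chae, J. Funct. Anal. 258 (2010) 2865–2883 = arXiv:0711.1113, Thm. 1.1 (the threshold). [Chae2010]
* H. Bahouri, J.-Y. Chemin, R. Danchin, Grundlehren 343 (2011), Lemma 2.1 (Bernstein), Prop. 2.12 (reconstruction).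
  [BahouriCheminDanchin2011]
* J. T. Beale, T. Kato, A. Majda, Comm. Math. Phys. 94 (1984) 61–66, Thm. 1. [BealeKatoMajda1984]
-/

noncomputable section

open MeasureTheory Set Function Filter Topology Metric
open scoped ENNReal NNReal
open Literature.Analysis.FluidPDE Literature.Analysis.FunctionSpaces
open Summit.NavierStokesRegularity.FluidComputer.BlockEnergyTransport
open Summit.NavierStokesRegularity.FluidComputer.SummedOccupationBridge
open Summit.NavierStokesRegularity.FluidComputer.TypeIGradientFace

namespace Summit.NavierStokesRegularity.FluidComputer.LipschitzRowWeakClock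

/-! ## The gradient against the Lipschitz row -/

/-- **`sup_x ‖∇v(x)‖ ≤ C_L ∑_l 2^l ‖Δ̇_l v‖_∞`** for every smooth `L²` field `v : ℝ³ → ℝ³`, with an absolute `C_L`
(operator norm of `∇v(x)`; `‖Dv(x)‖ ≤ ∑_i ‖∂_i v(x)‖ ≤ ∑_i ‖∂_i v‖_∞` and `exists_eLpNorm_fderiv_apply_le_tsum`).
[cite: BahouriCheminDanchin2011, Lemma 2.1 and Prop. 2.12] -/
theorem exists_iSup_fderiv_le_lipschitzRow :
    ∃ C : ℝ≥0, ∀ (v : EuclideanSpace ℝ (Fin 3) → EuclideanSpace ℝ (Fin 3)), IsSmoothL2Field v →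
      (⨆ x, ‖fderiv ℝ v x‖ₑ) ≤ C * ∑' j : ℤ, (2 : ℝ≥0∞) ^ j * blockSup v j := by
  obtain ⟨C, hC⟩ := exists_eLpNorm_fderiv_apply_le_tsum
  refine ⟨3 * C, fun v hv => iSup_le fun x => ?_⟩
  set S : ℝ≥0∞ := ∑' j : ℤ, (2 : ℝ≥0∞) ^ j * blockSup v j with hS
  have hcont : ∀ i : Fin 3, Continuous fun y => fderiv ℝ v y (EuclideanSpace.single i 1) :=
    fun i => (hv.fderiv_apply _).continuous
  -- `‖∂_i v (x)‖ ≤ C · S`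
  have hi : ∀ i : Fin 3, ‖fderiv ℝ v x (EuclideanSpace.single i 1)‖ₑ ≤ C * S := fun i => by
    refine (enorm_le_eLpNorm_top_of_continuous volume (hcont i) x).trans ?_
    refine (hC v hv (EuclideanSpace.single i 1)).trans (le_of_eq ?_)
    have h1 : ‖EuclideanSpace.single i (1 : ℝ)‖ₑ = 1 := by
      rw [← ofReal_norm]; simp
    rw [hS, h1, mul_one]
    rfl
  calc ‖fderiv ℝ v x‖ₑ ≤ ∑ i : Fin 3, ‖fderiv ℝ v x (EuclideanSpace.single i 1)‖ₑ := by
        rw [← ofReal_norm]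
        refine (ENNReal.ofReal_le_ofReal (opNorm_le_sum_norm_apply_single _)).trans (le_of_eq ?_)
        rw [ENNReal.ofReal_sum_of_nonneg fun i _ => norm_nonneg _]
        exact Finset.sum_congr rfl fun i _ => ofReal_norm _
    _ ≤ ∑ _i : Fin 3, C * S := Finset.sum_le_sum fun i _ => hi i
    _ = (3 * C : ℝ≥0) * S := by
        rw [Finset.sum_const, Finset.card_univ, Fintype.card_fin]; push_cast; ring

/-! ## L63′: the Lipschitz row at the self-similar rate, weak form -/

/-- **L63′ — THE LIPSCHITZ ROW `∑_l 2^l ‖Δ̇_l u(t)‖_∞` MUST REACH `1/(C_L (T − t))` ARBITRARILY CLOSE TO `T`.** With the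
absolute constant `C_L` of `exists_iSup_fderiv_le_lipschitzRow`: for every `ν > 0`, `T > 0`, every maximal smooth
solution `(u, p)` of the unforced Navier–Stokes system on `ℝ³ × [0, T)` which is Leray–Hopf from `u 0`, every `M₀ < 1`
and every `t₀ ∈ [0, T)`, some `t ∈ [t₀, T) ∩ (0, T)` has `M₀/(T − t) < C_L · ∑_l 2^l ‖Δ̇_l u(t)‖_∞` — the Type-I
gradient threshold L63 (`ns_typeI_gradient_threshold`, constant `1`) read through the reconstruction inequality on the
smooth `L²` slice `u(t)` (`isSmoothL2Field_slice_of_maximal`): `limsup_{t↑T} (T − t)·∑_l 2^l s_l(t) ≥ 1/C_L`. For the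
machine paradigm: the `2^l`-weighted row of block amplitudes in `L^∞` — the Lipschitz budget of the cascade — must
come back up to the self-similar level `≈ 1/(T − t)` again and again; no `ν`. Necessity only; weak form only.
[cite: Chae2010, Thm 1.1] [cite: BahouriCheminDanchin2011, Lemma 2.1 and Prop. 2.12] -/
theorem lipschitzRow_weak_clock {ν T : ℝ} (hν : 0 < ν) (hT : 0 < T)
    {u : ℝ → EuclideanSpace ℝ (Fin 3) → EuclideanSpace ℝ (Fin 3)} {p : ℝ → EuclideanSpace ℝ (Fin 3) → ℝ}
    (hmax : IsMaximalSmoothSolution ν 0 u p T) (hLH : IsLerayHopfOn T ν 0 (u 0) u)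
    {M₀ : ℝ} (hM₀ : M₀ < 1) {t₀ : ℝ} (ht₀ : t₀ ∈ Ico 0 T) :
    ∃ t ∈ Ico t₀ T, 0 < t ∧
      ENNReal.ofReal (M₀ / (T - t)) <
        exists_iSup_fderiv_le_lipschitzRow.choose * ∑' j : ℤ, (2 : ℝ≥0∞) ^ j * blockSup (u t) j := by
  have hCL := exists_iSup_fderiv_le_lipschitzRow.choose_spec
  set CL : ℝ≥0 := exists_iSup_fderiv_le_lipschitzRow.choose with hCLdef
  -- a non-negative threshold `M₁ = max M₀ 0 < 1` and a positive starting time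
  set M₁ : ℝ := max M₀ 0 with hM₁
  have hM₁1 : M₁ < 1 := max_lt hM₀ one_pos
  have hM₁0 : 0 ≤ M₁ := le_max_right _ _
  set t₁ : ℝ := (t₀ + T) / 2 with ht₁def
  have ht₁ : t₁ ∈ Ico 0 T := ⟨by rw [ht₁def]; linarith [ht₀.1, ht₀.2], by rw [ht₁def]; linarith [ht₀.2]⟩
  have ht₀₁ : t₀ < t₁ := by rw [ht₁def]; linarith [ht₀.2]
  have ht₁0 : 0 < t₁ := by rw [ht₁def]; linarith [ht₀.1, ht₀.2]
  obtain ⟨t, ht, x, hx⟩ := ns_typeI_gradient_threshold hν hT hmax hLH hM₁1 ht₁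
  have ht0 : 0 < t := ht₁0.trans_le ht.1
  refine ⟨t, ⟨ht₀₁.le.trans ht.1, ht.2⟩, ht0, ?_⟩
  have hTt : 0 < T - t := sub_pos.2 ht.2
  have hsm : IsSmoothL2Field (u t) := isSmoothL2Field_slice_of_maximal hν hT hmax hLH ⟨ht0, ht.2⟩
  have h1 : M₁ / (T - t) < ‖fderiv ℝ (u t) x‖ := by
    rw [div_lt_iff₀ hTt]
    linarith
  have h1pos : 0 < ‖fderiv ℝ (u t) x‖ := lt_of_le_of_lt (div_nonneg hM₁0 hTt.le) h1
  have h0 : M₀ / (T - t) ≤ M₁ / (T - t) := div_le_div_of_nonneg_right (le_max_left _ _) hTt.le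
  calc ENNReal.ofReal (M₀ / (T - t)) ≤ ENNReal.ofReal (M₁ / (T - t)) := ENNReal.ofReal_le_ofReal h0
    _ < ‖fderiv ℝ (u t) x‖ₑ := by
        rw [← ofReal_norm]
        exact (ENNReal.ofReal_lt_ofReal_iff h1pos).2 h1
    _ ≤ ⨆ y : EuclideanSpace ℝ (Fin 3), ‖fderiv ℝ (u t) y‖ₑ := le_iSup (fun y => ‖fderiv ℝ (u t) y‖ₑ) x
    _ ≤ CL * ∑' j : ℤ, (2 : ℝ≥0∞) ^ j * blockSup (u t) j := hCL (u t) hsm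

/-- **L63′, filter form**: with the constant `C_L` of `exists_iSup_fderiv_le_lipschitzRow`, along every maximal smooth
Leray–Hopf solution of the unforced system (`ν > 0`), for every `M₀ < 1`:
`∃ᶠ t in 𝓝[<] T, M₀/(T − t) < C_L · ∑_l 2^l ‖Δ̇_l u(t)‖_∞`. [cite: Chae2010, Thm 1.1]
[cite: BahouriCheminDanchin2011, Prop. 2.12] -/
theorem lipschitzRow_weak_clock_frequently {ν T : ℝ} (hν : 0 < ν) (hT : 0 < T)
    {u : ℝ → EuclideanSpace ℝ (Fin 3) → EuclideanSpace ℝ (Fin 3)} {p : ℝ → EuclideanSpace ℝ (Fin 3) → ℝ}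
    (hmax : IsMaximalSmoothSolution ν 0 u p T) (hLH : IsLerayHopfOn T ν 0 (u 0) u)
    {M₀ : ℝ} (hM₀ : M₀ < 1) :
    ∃ᶠ t in 𝓝[<] T, ENNReal.ofReal (M₀ / (T - t)) <
      exists_iSup_fderiv_le_lipschitzRow.choose * ∑' j : ℤ, (2 : ℝ≥0∞) ^ j * blockSup (u t) j := by
  rw [Filter.frequently_iff]
  intro U hU
  obtain ⟨l, hl, hlU⟩ := mem_nhdsLT_iff_exists_Ioo_subset.1 hU
  set t₀ : ℝ := (max l 0 + T) / 2 with ht₀def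
  have hm : max l 0 < T := max_lt hl hT
  have ht₀ : t₀ ∈ Ico 0 T := ⟨by rw [ht₀def]; linarith [le_max_right l 0], by rw [ht₀def]; linarith⟩
  have hlt₀ : l < t₀ := by rw [ht₀def]; linarith [le_max_left l 0]
  obtain ⟨t, ht, -, hx⟩ := lipschitzRow_weak_clock hν hT hmax hLH hM₀ ht₀
  exact ⟨t, hlU ⟨hlt₀.trans_le ht.1, ht.2⟩, hx⟩

end Summit.NavierStokesRegularity.FluidComputer.LipschitzRowWeakClock

end
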